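import Summits.Parity.GeneralizedHardyLittlewood.Theorems.LiouvilleMADTypeIIToLevel
import HarnessLib

/-!
# Crux `LiouvilleMAD.LambdaLiouvilleLevel` (stmt-Parity-13325), line `log-power-dispersion`:
# stub `stub_typeIIPiece` — auxiliary estimates

Support file for the stub `stub_typeIIPiece`
(`ClassDivisorShortSum → TypeIIPieceDecomp → ClassTypeIILog h → TypeIIPieceLog h`, the `ℓ²`
bookkeeping of the line's type-II engine), proved in
`LiouvilleMADLambdaLiouvilleLevelStubTypeIIPiece.lean`.

Contents (all parameters explicit, pure bookkeeping):
* `alpha_sq_sum_le`: on one short interval `(E_a, E_{a+1}]` of the dyadic block `(D, 2D]`,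
  `E_a = D + ⌊aD/K_s⌋`, the coefficients `α d = Λ(d) 1_{(E_a, E_{a+1}]}(d)` have
  `Σ_{d ∼ D} α(d)² ≤ (D/K_s + 1) L²` once `log(2D) ≤ L` (`Λ ≤ log`,
  `E_{a+1} − E_a ≤ D/K_s + 1`);
* `beta_sq_sum_le`: `β m = G_U(m) 1[m ≤ X]` has `Σ_{m ∼ M} β(m)² ≤ C_τ (2M) L⁸`
  (`|G_U| ≤ τ`, `Σ_{n ≤ x} τ(n)² ≤ C_τ x log⁸ x`);
* `sum_filter_dyadic_le`: `Σ_{j : D·U2^j ≤ N} D·U2^j ≤ 2N` (geometric sum);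
* `box_numeric`, `main_numeric`: the real arithmetic turning `C √P √R √(DM) (log N)^{-A'}` into
  `≪ (log N)^{5−A'} DM (K_s^{-1/2} + U^{-1/2})` and summing the boxes;
* `boundary_q`, `boundary_total` (closed form `typeIIPiece_boundary_total`): the boundary strip,
  `log N · Σ_{q ≤ Q} [2((N/K_s+1)/q + 1)(1 + log N) + 2√N] ≤ 22 N/(log N)^A` for
  `K_s ≥ (log N)^{2A+6}`, `Q ≤ N^{1/4}`.
-/

noncomputable section

open Finset Real
open scoped ArithmeticFunction.sigma

namespace Summit.Parity.GeneralizedHardyLittlewood.Theorems.LambdaLiouvilleLevel.LogPowerDispersion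

open Literature.NumberTheory.Sieve.Vaughan (fU gU abs_gU_le)

/-- `log n ≤ L` for naturals `n ≤ N` once `log N ≤ L` and `0 ≤ L` (covers `n = 0`). [folklore] -/
theorem log_natCast_le {n N : ℕ} {L : ℝ} (h : n ≤ N) (hL : Real.log N ≤ L) (hL0 : 0 ≤ L) :
    Real.log n ≤ L := by
  rcases Nat.eq_zero_or_pos n with h0 | hpos
  · rw [h0, Nat.cast_zero, Real.log_zero]; exact hL0
  · exact (Real.log_le_log (by exact_mod_cast hpos) (by exact_mod_cast h)).trans hL

/-- **`ℓ²` norm of the row coefficients.** On the short interval `(E_a, E_{a+1}]`,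
`E_a = D + ⌊aD/K_s⌋`, of the block `(D, 2D]`:
`Σ_{D < d ≤ 2D} (Λ(d) 1[E_a < d ≤ E_{a+1}])² ≤ (D/K_s + 1) L²` when `log(2D) ≤ L`
(`0 ≤ Λ(d) ≤ log d ≤ log 2D`, and `E_{a+1} − E_a ≤ D/K_s + 1`). [folklore] -/
theorem alpha_sq_sum_le (D Ks a : ℕ) (hKs : 0 < Ks) {L : ℝ} (hL : Real.log (2 * D) ≤ L) :
    ∑ d ∈ Ioc D (2 * D), (ArithmeticFunction.vonMangoldt d *
        (if D + a * D / Ks < d ∧ d ≤ D + (a + 1) * D / Ks then (1 : ℝ) else 0)) ^ 2 ≤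
      ((D / Ks + 1 : ℕ) : ℝ) * L ^ 2 := by
  have hstep : D + (a + 1) * D / Ks - (D + a * D / Ks) ≤ D / Ks + 1 := by
    have : (a * D + D) / Ks ≤ a * D / Ks + D / Ks + 1 := by
      rw [Nat.add_div hKs]; split_ifs <;> omega
    rw [show (a + 1) * D = a * D + D by ring]
    generalize (a * D + D) / Ks = p at this ⊢
    generalize a * D / Ks = r at this ⊢
    generalize D / Ks = s at this ⊢
    omega
  have hΛ : ∀ d ∈ Ioc D (2 * D), ArithmeticFunction.vonMangoldt d ^ 2 ≤ L ^ 2 := by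
    intro d hd
    rw [mem_Ioc] at hd
    have hd0 : (0 : ℝ) < d := by exact_mod_cast (by omega : 0 < d)
    have hdle : (d : ℝ) ≤ 2 * D := by exact_mod_cast hd.2
    exact pow_le_pow_left₀ ArithmeticFunction.vonMangoldt_nonneg
      (ArithmeticFunction.vonMangoldt_le_log.trans ((Real.log_le_log hd0 hdle).trans hL)) 2
  calc ∑ d ∈ Ioc D (2 * D), (ArithmeticFunction.vonMangoldt d *
        (if D + a * D / Ks < d ∧ d ≤ D + (a + 1) * D / Ks then (1 : ℝ) else 0)) ^ 2
      = ∑ d ∈ Ioc D (2 * D), (if D + a * D / Ks < d ∧ d ≤ D + (a + 1) * D / Ks then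
          ArithmeticFunction.vonMangoldt d ^ 2 else 0) := by
        refine sum_congr rfl fun d _ => ?_
        split_ifs <;> simp
    _ = ∑ d ∈ (Ioc D (2 * D)).filter (fun d => D + a * D / Ks < d ∧ d ≤ D + (a + 1) * D / Ks),
          ArithmeticFunction.vonMangoldt d ^ 2 := (sum_filter _ _).symm
    _ ≤ ∑ d ∈ (Ioc D (2 * D)).filter (fun d => D + a * D / Ks < d ∧ d ≤ D + (a + 1) * D / Ks),
          L ^ 2 := sum_le_sum fun d hd => hΛ d (mem_filter.1 hd).1
    _ = (((Ioc D (2 * D)).filter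
          (fun d => D + a * D / Ks < d ∧ d ≤ D + (a + 1) * D / Ks)).card : ℝ) * L ^ 2 := by
        rw [sum_const, nsmul_eq_mul]
    _ ≤ ((D / Ks + 1 : ℕ) : ℝ) * L ^ 2 := by
        refine mul_le_mul_of_nonneg_right ?_ (sq_nonneg L)
        have hsub : (Ioc D (2 * D)).filter
            (fun d => D + a * D / Ks < d ∧ d ≤ D + (a + 1) * D / Ks) ⊆
            Ioc (D + a * D / Ks) (D + (a + 1) * D / Ks) := fun d hd =>
          mem_Ioc.2 (mem_filter.1 hd).2
        exact_mod_cast ((card_le_card hsub).trans_eq (Nat.card_Ioc _ _)).trans hstep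

/-- **`ℓ²` norm of the column coefficients.** `Σ_{M < m ≤ 2M} (G_U(m) 1[m ≤ X])² ≤ C_τ (2M) L⁸`
when `log(2M) ≤ L`, `M ≥ 1`: `|G_U(m)| ≤ τ(m)` (`Vaughan.abs_gU_le`) and
`Σ_{n ≤ x} τ(n)² ≤ C_τ x (log x)⁸` (`Sieve.exists_sum_sigma_zero_pow_le_real 2`). [folklore] -/
theorem beta_sq_sum_le {Cτ : ℝ}
    (hτ : ∀ x : ℝ, 2 ≤ x →
      ∑ n ∈ Icc 1 ⌊x⌋₊, (σ 0 n : ℝ) ^ 2 ≤ Cτ * x * Real.log x ^ (2 ^ (2 + 1)))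
    (hCτ : 0 ≤ Cτ) (U M X : ℕ) (hM : 1 ≤ M) {L : ℝ} (hL : Real.log (2 * M) ≤ L) :
    ∑ m ∈ Ioc M (2 * M), (gU U m * (if m ≤ X then (1 : ℝ) else 0)) ^ 2 ≤
      Cτ * (2 * M) * L ^ 8 := by
  have h1 : ∀ m, (gU U m * (if m ≤ X then (1 : ℝ) else 0)) ^ 2 ≤ (σ 0 m : ℝ) ^ 2 := by
    intro m
    have hg := abs_gU_le U m
    have : |gU U m * (if m ≤ X then (1 : ℝ) else 0)| ≤ σ 0 m := by
      rw [abs_mul]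
      split_ifs
      · simpa using hg
      · simp
    calc (gU U m * (if m ≤ X then (1 : ℝ) else 0)) ^ 2
        = |gU U m * (if m ≤ X then (1 : ℝ) else 0)| ^ 2 := (sq_abs _).symm
      _ ≤ (σ 0 m : ℝ) ^ 2 := pow_le_pow_left₀ (abs_nonneg _) this 2
  have h2M : (2 : ℝ) ≤ ((2 * M : ℕ) : ℝ) := by exact_mod_cast (by omega : 2 ≤ 2 * M)
  have hsub : Ioc M (2 * M) ⊆ Icc 1 ⌊((2 * M : ℕ) : ℝ)⌋₊ := by
    rw [Nat.floor_natCast]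
    intro m hm
    rw [mem_Ioc] at hm
    rw [mem_Icc]; omega
  have hlog0 : 0 ≤ Real.log ((2 * M : ℕ) : ℝ) := Real.log_nonneg (by linarith)
  have hlogL : Real.log ((2 * M : ℕ) : ℝ) ≤ L := by push_cast; exact hL
  calc ∑ m ∈ Ioc M (2 * M), (gU U m * (if m ≤ X then (1 : ℝ) else 0)) ^ 2
      ≤ ∑ m ∈ Ioc M (2 * M), (σ 0 m : ℝ) ^ 2 := sum_le_sum fun m _ => h1 m
    _ ≤ ∑ n ∈ Icc 1 ⌊((2 * M : ℕ) : ℝ)⌋₊, (σ 0 n : ℝ) ^ 2 :=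
        sum_le_sum_of_subset_of_nonneg hsub fun _ _ _ => sq_nonneg _
    _ ≤ Cτ * ((2 * M : ℕ) : ℝ) * Real.log ((2 * M : ℕ) : ℝ) ^ (2 ^ (2 + 1)) := hτ _ h2M
    _ ≤ Cτ * ((2 * M : ℕ) : ℝ) * L ^ (2 ^ (2 + 1)) :=
        mul_le_mul_of_nonneg_left (pow_le_pow_left₀ hlog0 hlogL _) (by positivity)
    _ = Cτ * (2 * M) * L ^ 8 := by push_cast; norm_num

/-- **Dyadic sum.** `Σ_{j < J, D·(U2^j) ≤ N} D·(U 2^j) ≤ 2N`: the admissible `j` lie below the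
largest one, `j₀`, and `Σ_{j ≤ j₀} 2^j < 2^{j₀+1}`. [folklore] -/
theorem sum_filter_dyadic_le (D U J N : ℕ) :
    ∑ j ∈ (range J).filter (fun j : ℕ => D * (U * 2 ^ j) ≤ N), (D : ℝ) * ((U * 2 ^ j : ℕ) : ℝ) ≤
      2 * N := by
  set S := (range J).filter (fun j : ℕ => D * (U * 2 ^ j) ≤ N) with hS
  rcases S.eq_empty_or_nonempty with h0 | hne
  · rw [h0, sum_empty]; positivity
  · set j₀ := S.max' hne with hj₀
    have hj₀S : j₀ ∈ S := S.max'_mem hne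
    have hj₀N : D * (U * 2 ^ j₀) ≤ N := (mem_filter.1 hj₀S).2
    have hsub : S ⊆ range (j₀ + 1) := fun j hj =>
      mem_range.2 (Nat.lt_succ_of_le (S.le_max' j hj))
    have hgeom : ∑ j ∈ range (j₀ + 1), (2 : ℝ) ^ j = 2 ^ (j₀ + 1) - 1 := by
      rw [geom_sum_eq (by norm_num) (j₀ + 1)]; norm_num
    have hDU : (0 : ℝ) ≤ (D : ℝ) * U := by positivity
    have hcast : ((D * (U * 2 ^ j₀) : ℕ) : ℝ) ≤ N := by exact_mod_cast hj₀N
    calc ∑ j ∈ S, (D : ℝ) * ((U * 2 ^ j : ℕ) : ℝ)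
        ≤ ∑ j ∈ range (j₀ + 1), (D : ℝ) * ((U * 2 ^ j : ℕ) : ℝ) :=
          sum_le_sum_of_subset_of_nonneg hsub fun _ _ _ => by positivity
      _ = (D : ℝ) * U * ∑ j ∈ range (j₀ + 1), (2 : ℝ) ^ j := by
          rw [mul_sum]; refine sum_congr rfl fun j _ => ?_; push_cast; ring
      _ = (D : ℝ) * U * (2 ^ (j₀ + 1) - 1) := by rw [hgeom]
      _ ≤ 2 * ((D * (U * 2 ^ j₀) : ℕ) : ℝ) := by
          push_cast; rw [pow_succ]; nlinarith [pow_nonneg (zero_le_two (α := ℝ)) j₀]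
      _ ≤ 2 * N := by linarith

/-- `Σ_{q ≤ Q} 1/q ≤ 1 + log Q ≤ 2L` once `log Q ≤ L`, `1 ≤ L`
(Mathlib's `harmonic_le_one_add_log`). [folklore] -/
theorem sum_Icc_one_div_le (Q : ℕ) {L : ℝ} (hL : 1 ≤ L) (hQ : Real.log Q ≤ L) :
    ∑ q ∈ Icc 1 Q, (1 : ℝ) / q ≤ 2 * L := by
  have h := harmonic_le_one_add_log Q
  rw [harmonic_eq_sum_Icc, Rat.cast_sum] at h
  push_cast at h
  have : ∑ q ∈ Icc 1 Q, (1 : ℝ) / q ≤ 1 + Real.log Q := by simpa only [one_div] using h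
  linarith

/-- `J = log₂ N + 1 ≤ 3 log N` once `log N ≥ 1` (as in `TypeIIToLevel_proof`). [folklore] -/
theorem natLog_two_succ_le {N : ℕ} (hN : N ≠ 0) {L : ℝ} (hL : Real.log N ≤ L) (hL1 : 1 ≤ L) :
    ((Nat.log 2 N + 1 : ℕ) : ℝ) ≤ 3 * L := by
  have h2J' : ((2 ^ Nat.log 2 N : ℕ) : ℝ) ≤ N := by exact_mod_cast Nat.pow_log_le_self 2 hN
  have hlog2 : Real.log 2 * (Nat.log 2 N) ≤ L := by
    have := Real.log_le_log (by positivity) h2J'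
    rw [Nat.cast_pow, Nat.cast_ofNat, Real.log_pow] at this
    linarith
  have hl2 : (1 / 2 : ℝ) < Real.log 2 := by have := Real.log_two_gt_d9; linarith
  have hk0 : (0 : ℝ) ≤ Nat.log 2 N := Nat.cast_nonneg _
  have hk : (Nat.log 2 N : ℝ) * (1 / 2) ≤ (Nat.log 2 N : ℝ) * Real.log 2 :=
    mul_le_mul_of_nonneg_left hl2.le hk0
  push_cast
  linarith [mul_comm (Nat.log 2 N : ℝ) (Real.log 2)]

/-- **One box, numerically.** With `P = (D/K_s + 1) L²`, `R = C_τ (2M) L⁸` and `U ≤ D`: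
`C √P √R √(DM) / Λ ≤ max(C,0) √(2C_τ) L⁵ / Λ · (K_s^{-1/2} + U^{-1/2}) · DM`
(`√(D/K_s + 1) ≤ √D/√K_s + 1`, `√D · M ≤ DM/√U`). [folklore] -/
theorem box_numeric {C₂ Cτ L LA : ℝ} {D M Ks U : ℕ} (hL : 0 ≤ L) (hLA : 0 < LA)
    (hU : 0 < U) (hUD : U ≤ D) :
    C₂ * Real.sqrt (((D / Ks + 1 : ℕ) : ℝ) * L ^ 2) * Real.sqrt (Cτ * (2 * M) * L ^ 8) *
        Real.sqrt ((D : ℝ) * M) / LA ≤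
      max C₂ 0 * Real.sqrt (2 * Cτ) * L ^ 5 / LA * (1 / Real.sqrt Ks + 1 / Real.sqrt U) *
        ((D : ℝ) * M) := by
  set sD := Real.sqrt D with hsD
  set sM := Real.sqrt M with hsM
  set sK := Real.sqrt Ks with hsK
  set sU := Real.sqrt U with hsU
  have hsD0 : 0 ≤ sD := Real.sqrt_nonneg _
  have hsU0 : 0 < sU := Real.sqrt_pos.2 (by exact_mod_cast hU)
  have hsUD : sU ≤ sD := Real.sqrt_le_sqrt (by exact_mod_cast hUD)
  have hDsq : (D : ℝ) = sD ^ 2 := (Real.sq_sqrt (Nat.cast_nonneg _)).symm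
  have hMsq : (M : ℝ) = sM ^ 2 := (Real.sq_sqrt (Nat.cast_nonneg _)).symm
  -- `√P ≤ (sD / sK + 1) L`
  have hP : Real.sqrt (((D / Ks + 1 : ℕ) : ℝ) * L ^ 2) ≤ (sD / sK + 1) * L := by
    rw [Real.sqrt_mul' _ (sq_nonneg L), Real.sqrt_sq hL]
    refine mul_le_mul_of_nonneg_right ?_ hL
    have h1 : ((D / Ks + 1 : ℕ) : ℝ) ≤ (D : ℝ) / Ks + 1 := by
      have h0 : ((D / Ks : ℕ) : ℝ) ≤ (D : ℝ) / Ks := Nat.cast_div_le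
      push_cast; linarith
    calc Real.sqrt ((D / Ks + 1 : ℕ) : ℝ) ≤ Real.sqrt ((D : ℝ) / Ks + 1) := Real.sqrt_le_sqrt h1
      _ ≤ Real.sqrt ((D : ℝ) / Ks) + 1 := by
          rw [Real.sqrt_le_left (by positivity)]
          have h0 : 0 ≤ Real.sqrt ((D : ℝ) / Ks) := Real.sqrt_nonneg _
          nlinarith [Real.sq_sqrt (show (0 : ℝ) ≤ (D : ℝ) / Ks by positivity)]
      _ = sD / sK + 1 := by rw [Real.sqrt_div' _ (Nat.cast_nonneg _)]
  -- `√R = √(2Cτ) sM L⁴`, `√(DM) = sD sM`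
  have hR : Real.sqrt (Cτ * (2 * M) * L ^ 8) = Real.sqrt (2 * Cτ) * sM * L ^ 4 := by
    rw [show Cτ * (2 * M) * L ^ 8 = (2 * Cτ) * M * (L ^ 4) ^ 2 by ring,
      Real.sqrt_mul' _ (sq_nonneg _), Real.sqrt_sq (by positivity),
      Real.sqrt_mul' _ (Nat.cast_nonneg _)]
  have hDM : Real.sqrt ((D : ℝ) * M) = sD * sM := Real.sqrt_mul (Nat.cast_nonneg _) _
  have hkey : sD ≤ sD ^ 2 / sU := by
    rw [le_div_iff₀ hsU0, sq]; exact mul_le_mul_of_nonneg_left hsUD hsD0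
  have hC0 : 0 ≤ max C₂ 0 := le_max_right _ _
  set K₀ := max C₂ 0 * Real.sqrt (2 * Cτ) * L ^ 5 * sM ^ 2 with hK₀
  have hK₀0 : 0 ≤ K₀ := by positivity
  have hmain : C₂ * Real.sqrt (((D / Ks + 1 : ℕ) : ℝ) * L ^ 2) *
      Real.sqrt (Cτ * (2 * M) * L ^ 8) * Real.sqrt ((D : ℝ) * M) ≤
      max C₂ 0 * Real.sqrt (2 * Cτ) * L ^ 5 * (1 / sK + 1 / sU) * ((D : ℝ) * M) := by
    calc C₂ * Real.sqrt (((D / Ks + 1 : ℕ) : ℝ) * L ^ 2) * Real.sqrt (Cτ * (2 * M) * L ^ 8) *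
          Real.sqrt ((D : ℝ) * M)
        ≤ max C₂ 0 * Real.sqrt (((D / Ks + 1 : ℕ) : ℝ) * L ^ 2) *
          Real.sqrt (Cτ * (2 * M) * L ^ 8) * Real.sqrt ((D : ℝ) * M) := by
          gcongr; exact le_max_left _ _
      _ ≤ max C₂ 0 * ((sD / sK + 1) * L) * (Real.sqrt (2 * Cτ) * sM * L ^ 4) * (sD * sM) := by
          rw [hR, hDM]; gcongr
      _ = K₀ * (sD ^ 2 / sK + sD) := by rw [hK₀]; ring
      _ ≤ K₀ * (sD ^ 2 / sK + sD ^ 2 / sU) := mul_le_mul_of_nonneg_left (by linarith) hK₀0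
      _ = max C₂ 0 * Real.sqrt (2 * Cτ) * L ^ 5 * (1 / sK + 1 / sU) * ((D : ℝ) * M) := by
          rw [hDsq, hMsq, hK₀]; ring
  calc C₂ * Real.sqrt (((D / Ks + 1 : ℕ) : ℝ) * L ^ 2) * Real.sqrt (Cτ * (2 * M) * L ^ 8) *
        Real.sqrt ((D : ℝ) * M) / LA
      ≤ max C₂ 0 * Real.sqrt (2 * Cτ) * L ^ 5 * (1 / sK + 1 / sU) * ((D : ℝ) * M) / LA :=
        div_le_div_of_nonneg_right hmain hLA.le
    _ = _ := by ring

/-- **Summing the boxes, numerically.** With `Λ' = L⁶ t Λ`, `J ≤ 3L`, `K_s ≤ U`, `K_s ≤ t² + 1`,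
`t ≥ 1`: `J · K_s · (c L⁵/Λ' · (K_s^{-1/2} + U^{-1/2}) · 2N) ≤ 24 c N / Λ`
(`K_s (K_s^{-1/2} + U^{-1/2}) ≤ 2 √K_s ≤ 4t`). [folklore] -/
theorem main_numeric {c₁ L t LA LA' : ℝ} {J Ks U : ℕ} (N : ℕ) (hc₁ : 0 ≤ c₁) (hL : 1 ≤ L)
    (ht : 1 ≤ t) (hLA : 0 < LA) (hLA' : LA' = L ^ 6 * t * LA) (hJ : (J : ℝ) ≤ 3 * L)
    (hKs : 0 < Ks) (hKsU : Ks ≤ U) (hKst : (Ks : ℝ) ≤ t ^ 2 + 1) :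
    (J : ℝ) * ((Ks : ℝ) * (c₁ * L ^ 5 / LA' * (1 / Real.sqrt Ks + 1 / Real.sqrt U) * (2 * N))) ≤
      24 * c₁ * N / LA := by
  set sK := Real.sqrt Ks with hsK
  set sU := Real.sqrt U with hsU
  have hKs0 : (0 : ℝ) < Ks := by exact_mod_cast hKs
  have hsK0 : 0 < sK := Real.sqrt_pos.2 hKs0
  have hsU0 : 0 < sU := Real.sqrt_pos.2 (by exact_mod_cast hKs.trans_le hKsU)
  have hsKU : sK ≤ sU := Real.sqrt_le_sqrt (by exact_mod_cast hKsU)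
  have hKsq : (Ks : ℝ) = sK * sK := (Real.mul_self_sqrt hKs0.le).symm
  have ht0 : 0 ≤ t := by linarith
  have hsKt : sK ≤ 2 * t := by
    calc sK ≤ Real.sqrt ((t + 1) ^ 2) := Real.sqrt_le_sqrt (by nlinarith)
      _ = t + 1 := Real.sqrt_sq (by linarith)
      _ ≤ 2 * t := by linarith
  have h1 : (Ks : ℝ) * (1 / sK + 1 / sU) ≤ 4 * t := by
    have ha : (Ks : ℝ) * (1 / sK) = sK := by rw [hKsq]; field_simp
    have hb : (Ks : ℝ) * (1 / sU) ≤ sK := by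
      rw [hKsq, mul_one_div, div_le_iff₀ hsU0]
      exact mul_le_mul_of_nonneg_left hsKU hsK0.le
    calc (Ks : ℝ) * (1 / sK + 1 / sU) = Ks * (1 / sK) + Ks * (1 / sU) := by ring
      _ ≤ sK + sK := by rw [ha]; linarith
      _ ≤ 4 * t := by linarith
  have hL0 : 0 < L := by linarith
  have hLA'0 : 0 < LA' := by rw [hLA']; positivity
  have h2 : 0 ≤ c₁ * L ^ 5 * (2 * N) / LA' := by positivity
  have hLne : L ≠ 0 := hL0.ne'
  have htne : t ≠ 0 := by positivity
  have hLAne : LA ≠ 0 := hLA.ne'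
  calc (J : ℝ) * ((Ks : ℝ) * (c₁ * L ^ 5 / LA' * (1 / sK + 1 / sU) * (2 * N)))
      = (J * ((Ks : ℝ) * (1 / sK + 1 / sU))) * (c₁ * L ^ 5 * (2 * N) / LA') := by ring
    _ ≤ (3 * L * (4 * t)) * (c₁ * L ^ 5 * (2 * N) / LA') :=
        mul_le_mul_of_nonneg_right (mul_le_mul hJ h1 (by positivity) (by positivity)) h2
    _ = 24 * c₁ * N / LA := by
        rw [hLA']
        field_simp
        ring

/-- **The boundary strip at one modulus.** From `ClassDivisorShortSum` at `Z₂ = y_q ≤ N`,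
`Z₁ = y_q − (N/K_s + 1)`: `Σ ≤ 4L(N/K_s + 1)/q + 4L + 2√N` (`1 + log y_q ≤ 2L`). [folklore] -/
theorem boundary_q {q N Ks yq : ℕ} {L S : ℝ} (hq : 1 ≤ q) (hy : yq ≤ N) (hL1 : 1 ≤ L)
    (hLN : Real.log N ≤ L)
    (h : S ≤ 2 * ((((yq - (yq - (N / Ks + 1)) : ℕ) : ℝ)) / q + 1) * (1 + Real.log yq) +
      2 * Real.sqrt yq) :
    S ≤ 4 * L * ((N : ℝ) / Ks + 1) / q + 4 * L + 2 * Real.sqrt N := by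
  have hq0 : (0 : ℝ) < q := by exact_mod_cast hq
  have hΔ : (((yq - (yq - (N / Ks + 1)) : ℕ) : ℝ)) ≤ (N : ℝ) / Ks + 1 := by
    have h1 : yq - (yq - (N / Ks + 1)) ≤ N / Ks + 1 := by
      generalize N / Ks + 1 = r; omega
    have h0 : ((N / Ks : ℕ) : ℝ) ≤ (N : ℝ) / Ks := Nat.cast_div_le
    calc (((yq - (yq - (N / Ks + 1)) : ℕ) : ℝ)) ≤ ((N / Ks + 1 : ℕ) : ℝ) := by exact_mod_cast h1
      _ ≤ (N : ℝ) / Ks + 1 := by push_cast; linarith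
  have hlogy : Real.log yq ≤ L := log_natCast_le hy hLN (by linarith)
  have hlogy0 : 0 ≤ Real.log yq := Real.log_natCast_nonneg _
  have hsq : Real.sqrt yq ≤ Real.sqrt N := Real.sqrt_le_sqrt (by exact_mod_cast hy)
  have hA : (((yq - (yq - (N / Ks + 1)) : ℕ) : ℝ)) / q + 1 ≤ ((N : ℝ) / Ks + 1) / q + 1 := by
    have := div_le_div_of_nonneg_right hΔ hq0.le; linarith
  have hB : 1 + Real.log yq ≤ 2 * L := by linarith
  have hAB := mul_le_mul hA hB (by positivity) (by positivity)
  calc S ≤ _ := h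
    _ ≤ 2 * ((((N : ℝ) / Ks + 1) / q + 1) * (2 * L)) + 2 * Real.sqrt N := by nlinarith
    _ = 4 * L * ((N : ℝ) / Ks + 1) / q + 4 * L + 2 * Real.sqrt N := by ring

/-- **The boundary strip, summed over the moduli.** With `t = Λ L³ ≥ 1`, `t ≤ R`, `Q ≤ R`,
`R² = √N`, `t² ≤ K_s`: `L · Σ_{q ≤ Q} (4L(N/K_s+1)/q + 4L + 2√N) ≤ 22 N/Λ`
(`Σ_{q ≤ Q} 1/q ≤ 2L`; the four terms are `≤ 8N, 8N, 4N, 2N`). [folklore] -/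
theorem boundary_total {L LA t R4 sN : ℝ} {Ks : ℕ} (Q N : ℕ) (hL : 1 ≤ L) (hLA : 1 ≤ LA)
    (ht : t = LA * L ^ 3) (htR : t ≤ R4) (hQ : (Q : ℝ) ≤ R4) (hR4 : 1 ≤ R4) (hsN1 : 1 ≤ sN)
    (hRs : R4 * R4 = sN) (hsN : sN * sN = N) (hKs : t ^ 2 ≤ Ks) (hLN : Real.log N ≤ L) :
    L * ∑ q ∈ Icc 1 Q, (4 * L * ((N : ℝ) / Ks + 1) / q + 4 * L + 2 * sN) ≤ 22 * N / LA := by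
  have hLA0 : 0 < LA := by linarith
  have hL0 : 0 < L := by linarith
  have ht1 : 1 ≤ t := by rw [ht]; exact one_le_mul_of_one_le_of_one_le hLA (one_le_pow₀ hL)
  have hKs0 : (0 : ℝ) < Ks := lt_of_lt_of_le (by positivity) hKs
  have hsNN : sN ≤ N := by rw [← hsN]; exact le_mul_of_one_le_right (by linarith) hsN1
  have hR4N : R4 ≤ N := by
    refine le_trans (le_mul_of_one_le_right (by linarith) hR4) ?_
    rw [hRs]; exact hsNN
  have hQN : Q ≤ N := by exact_mod_cast hQ.trans hR4N
  have hlogQ : Real.log Q ≤ L := log_natCast_le hQN hLN hL0.le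
  -- the sum over `q`
  have hsum : ∑ q ∈ Icc 1 Q, (4 * L * ((N : ℝ) / Ks + 1) / q + 4 * L + 2 * sN) ≤
      4 * L * ((N : ℝ) / Ks + 1) * (2 * L) + Q * (4 * L + 2 * sN) := by
    rw [sum_add_distrib, sum_add_distrib, sum_const, sum_const, Nat.card_Icc, Nat.add_sub_cancel,
      nsmul_eq_mul, nsmul_eq_mul]
    have h1 : ∑ q ∈ Icc 1 Q, 4 * L * ((N : ℝ) / Ks + 1) / q =
        4 * L * ((N : ℝ) / Ks + 1) * ∑ q ∈ Icc 1 Q, (1 : ℝ) / q := by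
      rw [mul_sum]; exact sum_congr rfl fun q _ => by ring
    rw [h1]
    have h3 : 4 * L * ((N : ℝ) / Ks + 1) * ∑ q ∈ Icc 1 Q, (1 : ℝ) / q ≤
        4 * L * ((N : ℝ) / Ks + 1) * (2 * L) :=
      mul_le_mul_of_nonneg_left (sum_Icc_one_div_le Q hL hlogQ) (by positivity)
    linarith
  -- the four terms
  have hT1 : L ^ 3 * LA * ((N : ℝ) / Ks) ≤ N := by
    have h3 : L ^ 3 * LA ≤ Ks := by
      calc L ^ 3 * LA = t := by rw [ht]; ring
        _ ≤ t ^ 2 := by nlinarith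
        _ ≤ Ks := hKs
    calc L ^ 3 * LA * ((N : ℝ) / Ks) ≤ Ks * ((N : ℝ) / Ks) :=
          mul_le_mul_of_nonneg_right h3 (by positivity)
      _ = N := by field_simp
  have hT2 : L ^ 3 * LA ≤ N := by
    calc L ^ 3 * LA = t := by rw [ht]; ring
      _ ≤ N := htR.trans hR4N
  have hT3 : (Q : ℝ) * (L ^ 2 * LA) ≤ N := by
    have hL2 : L ^ 2 * LA ≤ t := by
      rw [ht, mul_comm]
      exact mul_le_mul_of_nonneg_left (pow_le_pow_right₀ hL (by norm_num)) hLA0.le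
    calc (Q : ℝ) * (L ^ 2 * LA) ≤ R4 * t := mul_le_mul hQ hL2 (by positivity) (by linarith)
      _ ≤ R4 * R4 := mul_le_mul_of_nonneg_left htR (by linarith)
      _ = sN := hRs
      _ ≤ N := hsNN
  have hT4 : (Q : ℝ) * (L * LA) * sN ≤ N := by
    have hL1' : L * LA ≤ t := by
      rw [ht, mul_comm]
      exact mul_le_mul_of_nonneg_left (le_self_pow₀ hL (by norm_num)) hLA0.le
    calc (Q : ℝ) * (L * LA) * sN ≤ R4 * t * sN :=
          mul_le_mul_of_nonneg_right (mul_le_mul hQ hL1' (by positivity) (by linarith))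
            (by linarith)
      _ ≤ R4 * R4 * sN := by gcongr
      _ = N := by rw [hRs, hsN]
  rw [le_div_iff₀ hLA0]
  calc (L * ∑ q ∈ Icc 1 Q, (4 * L * ((N : ℝ) / Ks + 1) / q + 4 * L + 2 * sN)) * LA
      ≤ L * (4 * L * ((N : ℝ) / Ks + 1) * (2 * L) + Q * (4 * L + 2 * sN)) * LA :=
        mul_le_mul_of_nonneg_right (mul_le_mul_of_nonneg_left hsum hL0.le) hLA0.le
    _ = 8 * (L ^ 3 * LA * ((N : ℝ) / Ks)) + 8 * (L ^ 3 * LA) + 4 * ((Q : ℝ) * (L ^ 2 * LA)) +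
          2 * ((Q : ℝ) * (L * LA) * sN) := by ring
    _ ≤ 22 * N := by linarith

/-- **The boundary strips, closed form** (registered sub-goal of `stub_typeIIPiece`): for reals
`L, Λ ≥ 1`, `t = Λ L³ ≤ R`, `Q ≤ R`, `1 ≤ R`, `R² = s`, `s² = N`, `1 ≤ s`, `t² ≤ K_s`, `log N ≤ L`:
`L · Σ_{q ≤ Q} (4L(N/K_s+1)/q + 4L + 2s) ≤ 22 N/Λ` (this is `boundary_total`). [folklore] -/
theorem typeIIPiece_boundary_total :
    ∀ (L LA t R4 sN : ℝ) (Ks Q N : ℕ), 1 ≤ L → 1 ≤ LA → t = LA * L ^ 3 → t ≤ R4 →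
      (Q : ℝ) ≤ R4 → 1 ≤ R4 → 1 ≤ sN → R4 * R4 = sN → sN * sN = N → t ^ 2 ≤ (Ks : ℝ) →
      Real.log N ≤ L →
      L * ∑ q ∈ Finset.Icc 1 Q, (4 * L * ((N : ℝ) / Ks + 1) / q + 4 * L + 2 * sN) ≤
        22 * N / LA :=
  fun _ _ _ _ _ _ Q N hL hLA ht htR hQ hR4 hsN1 hRs hsN hKs hLN =>
    boundary_total Q N hL hLA ht htR hQ hR4 hsN1 hRs hsN hKs hLN

end Summit.Parity.GeneralizedHardyLittlewood.Theorems.LambdaLiouvilleLevel.LogPowerDispersion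

end
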